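import Summits.BirchSwinnertonDyer.Rank1Residual.GaloisImage.KolyvaginPrimeTransverse
import Literature.NumberTheory.GaloisRepresentations.SerreWeightExistenceProofs
import Literature.NumberTheory.GaloisRepresentations.TameInertiaProofs
import Literature.NumberTheory.GaloisRepresentations.RamificationFiltrationProofs
import HarnessLib

/-!
# Kolyvagin-prime LOCAL SHAPE, part (UT): `H¹_ur(K_𝔮, T̄) ⊔ 𝒯_𝔮 = H¹(K_𝔮, T̄)` at the
# Frobenius-class primes of `τ` — modulo the total ramification of `K_𝔮(μ_ℓ)/K_𝔮`
# (row T-R1-16-LOC, p18; p11's R1-16 binder (UT))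

HONEST FRAMING (cell `b2b-bsdres`, run/shared/lean/b2b/bsd-rank1-residual/, verbatim in every
file): the goal of the cell is to DELETE the COMBINATION-SHAPED residual classes of the
Birch–Swinnerton-Dyer formula for ALL analytic-rank `≤ 1` elliptic curves over `ℚ` — "full BSD
formula for every rank `≤ 1` curve in class `C`" assembled STRICTLY from published theorems — so
that the rank-`≤ 1` remainder becomes exactly the CONSTRUCTION-SHAPED classes, which are TYPED
(missing-input `Prop`s), NOT attempted. This is not "finishing BSD". Team n1011 (N10/N11, the
additive block `X4 ∧ p = 3`): research route; TOOL theorems of local Galois cohomology, no class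
theorem, nothing booked, no mark changed.  No definition, no named fact in
this file: the single local input of this row that the tree does not prove (`χ̄_ℓ` onto on the
inertia group of `K_𝔮`, i.e. `K_𝔮(μ_ℓ)/K_𝔮` totally ramified with group `(ℤ/ℓ)ˣ`) is the explicit
hypothesis `hχI`; the sibling `KolyvaginPrimeLocalShapeRat.lean` types it as a cited fact for
`K = ℚ` (Serre, *Local Fields* IV §4 Prop. 17–18) and gives the `ℚ`-readings.

## Content

Step A `cocycle_apply_eq_zero_of_mem_absInertia_of_modPCyclotomicCharacterZMod_eq_one` (a cocycle
vanishes on `I_F ∩ ker χ̄_ℓ`: the homomorphism `g ↦ ((m ↦ g m + φ g), χ̄_ℓ g)` into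
`Perm(M) × (ℤ/ℓ)ˣ` kills the wild inertia, `absUpperInertia_map_isPGroup_holds`, so its image of
`I_F` is cyclic, `absInertia_map_isCyclic_holds`, of order dividing `ℓ − 1` and onto `(ℤ/ℓ)ˣ`);
Step B `unramifiedSubgroup_sup_transverseSubgroup_cyclotomicField_eq_top` (transport `φ|_{I_F}`
along `χ̄_ℓ`: every class = unramified + transverse; Rubin PCMI Prop. 1.9.5 (3)); the global
(UT) at the Frobenius-class primes and the `K = ℚ` readings are in the sibling
`KolyvaginPrimeLocalShapeRat.lean`.

References: K. Rubin, *Euler systems and Kolyvagin systems* (PCMI 18, 2011) Prop. 1.9.5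
[Rubin2011]; B. Mazur, K. Rubin, Mem. AMS 799 (2004) Lemma 1.2.1, 1.2.4 [MazurRubin2004];
J.-P. Serre, *Local Fields* (1979) Ch. IV §2 Cor. 1 of Prop. 7, §4 Prop. 17–18
[SerreLocalFields1979].
-/

noncomputable section

open scoped Classical

universe u

namespace Summit.BirchSwinnertonDyer.Rank1Residual.GaloisImage

open CategoryTheory ContinuousCohomology Function Field ValuativeRel NumberField IsDedekindDomain
open Literature.NumberTheory.GaloisRepresentations
open Literature.NumberTheory.GaloisRepresentations.IsNonarchimedeanLocalField
open _root_.TopRep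
open Literature.NumberTheory.GaloisCohomology
open Literature.NumberTheory.Automorphic
open scoped NumberField

/-! ## (UT) Step A: a cocycle vanishes on `I ∩ ker χ̄_ℓ` (tame inertia is procyclic) -/

section TransverseVanishing

variable {F : Type u} [Field F] [ValuativeRel F] [TopologicalSpace F] [IsNonarchimedeanLocalField F]
  {M : Type u} [AddCommGroup M] [TopologicalSpace M] [DiscreteTopology M] [Finite M]
  (ρF : DiscreteGaloisModule F M) (ℓ : ℕ) [Fact ℓ.Prime] [NeZero (ℓ : F)]

/-- **Step A of (UT): a cocycle vanishes on `I_F ∩ ker χ̄_ℓ`** (`M` unramified, killed by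
`ℓ − 1`, residue characteristic `ℓ`, `χ̄_ℓ` onto on inertia): the continuous homomorphism
`g ↦ ((m ↦ g m + φ g), χ̄_ℓ g)`, `Γ_F → Perm(M) × (ℤ/ℓ)ˣ`, kills the wild inertia (values on `I_F`
of order dividing `ℓ − 1`; `absUpperInertia_map_isPGroup_holds`), so its image of `I_F` is CYCLIC
(`absInertia_map_isCyclic_holds`, Serre LF IV §2 Cor. 1 of Prop. 7) of order dividing `ℓ − 1` and
onto `(ℤ/ℓ)ˣ`; the projection to `(ℤ/ℓ)ˣ` is then injective on it, so an inertia element with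
`χ̄_ℓ = 1` translates `M` trivially: `φ t = 0`. [cite: Rubin2011, Prop. 1.9.5 (3) (p. 16)]
[cite: SerreLocalFields1979, Ch. IV §2, Cor. 1 of Prop. 7] -/
theorem cocycle_apply_eq_zero_of_mem_absInertia_of_modPCyclotomicCharacterZMod_eq_one
    (hchar : ringChar 𝓀[F] = ℓ)
    (hI : ∀ t ∈ absInertia F, ∀ m : M, ρF t m = m)
    (hM : ∀ m : M, (ℓ - 1) • m = 0)
    (hχI : ∀ u : (ZMod ℓ)ˣ, ∃ t ∈ absInertia F, modPCyclotomicCharacterZMod F ℓ t = u)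
    (φ : contOneCocycles ρF.toTopRep) {t : absoluteGaloisGroup F} (ht : t ∈ absInertia F)
    (hχt : modPCyclotomicCharacterZMod F ℓ t = 1) : φ.1 t = 0 := by
  classical
  set χ := modPCyclotomicCharacterZMod F ℓ
  have h1 : φ.1 1 = 0 := by
    have h := φ.2 1 1
    rw [mul_one] at h
    have h2 : ρF.toTopRep.ρ 1 (φ.1 1) = φ.1 1 := by simp
    rw [h2] at h
    have h' : φ.1 1 + φ.1 1 = φ.1 1 + 0 := by rw [add_zero]; exact h.symm
    exact add_left_cancel h'
  -- the affine permutation action `g ↦ (m ↦ g m + φ g)` (the splitting `Γ_F → M ⋊ Γ_F` of `φ`)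
  let A : absoluteGaloisGroup F →* Equiv.Perm M :=
    { toFun := fun g =>
        { toFun := fun m => ρF g m + φ.1 g
          invFun := fun m => ρF g⁻¹ (m - φ.1 g)
          left_inv := fun m => by
            change ρF g⁻¹ (ρF g m + φ.1 g - φ.1 g) = m
            rw [add_sub_cancel_right, ← Module.End.mul_apply, ← map_mul, inv_mul_cancel, map_one,
              Module.End.one_apply]
          right_inv := fun m => by
            change ρF g (ρF g⁻¹ (m - φ.1 g)) + φ.1 g = m
            rw [← Module.End.mul_apply, ← map_mul, mul_inv_cancel, map_one, Module.End.one_apply,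
              sub_add_cancel] }
      map_one' := by
        ext m
        change ρF 1 m + φ.1 1 = m
        rw [map_one, Module.End.one_apply, h1, add_zero]
      map_mul' := fun g h => by
        ext m
        change ρF (g * h) m + φ.1 (g * h) = ρF g (ρF h m + φ.1 h) + φ.1 g
        rw [map_mul, Module.End.mul_apply, φ.2 g h, map_add]
        change ρF g (ρF h m) + (φ.1 g + ρF g (φ.1 h)) = ρF g (ρF h m) + ρF g (φ.1 h) + φ.1 g
        abel }
  have hA : ∀ g m, A g m = ρF g m + φ.1 g := fun _ _ => rfl
  -- on inertia `A t` is the translation by `φ t`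
  have hApow : ∀ {t : absoluteGaloisGroup F}, (∀ m : M, ρF t m = m) → ∀ (n : ℕ) (m : M),
      (A t ^ n) m = m + n • φ.1 t := by
    intro t ht n m
    induction n with
    | zero => rw [pow_zero, Equiv.Perm.one_apply, zero_smul, add_zero]
    | succ n ih =>
      rw [pow_succ', Equiv.Perm.mul_apply, ih, hA, ht, succ_nsmul, add_assoc]
  -- discrete topology on the finite target
  letI : TopologicalSpace (Equiv.Perm M × (ZMod ℓ)ˣ) := ⊥
  haveI : DiscreteTopology (Equiv.Perm M × (ZMod ℓ)ˣ) := ⟨rfl⟩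
  let f₀ : absoluteGaloisGroup F →* Equiv.Perm M × (ZMod ℓ)ˣ := A.prod χ
  -- continuity: fibres are open
  have hχopen : ∀ u : (ZMod ℓ)ˣ, IsOpen {g : absoluteGaloisGroup F | χ g = u} := by
    intro u
    by_cases hu : ∃ g₀, χ g₀ = u
    · obtain ⟨g₀, hg₀⟩ := hu
      have hset : {g : absoluteGaloisGroup F | χ g = u} = (fun g => g₀⁻¹ * g) ⁻¹' (χ.ker : Set _) := by
        ext g
        simp only [Set.mem_setOf_eq, Set.mem_preimage, SetLike.mem_coe, MonoidHom.mem_ker, map_mul,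
          map_inv, hg₀]
        rw [inv_mul_eq_one, eq_comm]
      rw [hset]
      haveI : χ.ker.FiniteIndex := by
        haveI : Finite (absoluteGaloisGroup F ⧸ χ.ker) :=
          Finite.of_injective _ (QuotientGroup.kerLift_injective χ)
        exact Subgroup.finiteIndex_of_finite_quotient
      exact (Subgroup.isOpen_of_isClosed_of_finiteIndex χ.ker
        (isClosed_ker_modPCyclotomicCharacterZMod ℓ)).preimage (continuous_const.mul continuous_id)
    · have hset : {g : absoluteGaloisGroup F | χ g = u} = ∅ :=
        Set.eq_empty_iff_forall_notMem.2 fun g hg => hu ⟨g, hg⟩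
      rw [hset]; exact isOpen_empty
  have hcont : Continuous f₀ := by
    refine continuous_discrete_rng.2 fun b => ?_
    have hset : f₀ ⁻¹' {b} = (⋂ m : M, {g : absoluteGaloisGroup F | ρF g m + φ.1 g = b.1 m}) ∩
        {g | χ g = b.2} := by
      ext g
      simp only [Set.mem_preimage, Set.mem_singleton_iff, Set.mem_inter_iff, Set.mem_iInter,
        Set.mem_setOf_eq, f₀, MonoidHom.prod_apply, Prod.ext_iff]
      exact and_congr ⟨fun h m => by rw [← h]; rfl, fun h => Equiv.ext fun m => h m⟩ Iff.rfl
    rw [hset]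
    refine IsOpen.inter (isOpen_iInter_of_finite fun m => ?_) (hχopen b.2)
    exact (isOpen_discrete {b.1 m}).preimage ((ρF.continuous_apply_left m).add φ.1.continuous)
  let f : absoluteGaloisGroup F →ₜ* (Equiv.Perm M × (ZMod ℓ)ˣ) := ⟨f₀, hcont⟩
  have hf : ∀ g, f g = (A g, χ g) := fun _ => rfl
  -- on inertia, `(f σ)^(ℓ-1) = 1`
  have hpow : ∀ σ ∈ absInertia F, f σ ^ (ℓ - 1) = 1 := by
    intro σ hσ
    rw [hf, Prod.pow_mk, Prod.mk_eq_one]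
    constructor
    · ext m
      rw [hApow (hI σ hσ), hM, add_zero, Equiv.Perm.one_apply]
    · exact ZMod.units_pow_card_sub_one_eq_one ℓ (χ σ)
  -- `f` kills the wild inertia
  have hwild : ∀ v : ℝ, 0 < v → ∀ σ ∈ absUpperInertia F v, f σ = 1 := by
    intro v hv σ hσ
    have hσI : σ ∈ absInertia F := absUpperInertia_le_absInertia_holds F v hσ
    have hP := absUpperInertia_map_isPGroup_holds F (Equiv.Perm M × (ZMod ℓ)ˣ) f hv
    obtain ⟨k, hk⟩ := hP ⟨f σ, Subgroup.mem_map_of_mem _ hσ⟩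
    have hk' : f σ ^ (ringChar 𝓀[F]) ^ k = 1 := by
      have := congrArg Subtype.val hk
      rwa [SubmonoidClass.coe_pow, OneMemClass.coe_one] at this
    rw [hchar] at hk'
    have h1 : orderOf (f σ) ∣ ℓ ^ k := orderOf_dvd_of_pow_eq_one hk'
    have h2 : orderOf (f σ) ∣ ℓ - 1 := orderOf_dvd_of_pow_eq_one (hpow σ hσI)
    have hcop : Nat.Coprime (ℓ ^ k) (ℓ - 1) := by
      refine Nat.Coprime.pow_left k ?_
      have hℓ : 1 ≤ ℓ := (Fact.out : ℓ.Prime).one_lt.le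
      have : Nat.Coprime (ℓ - 1 + 1) (ℓ - 1) := Nat.coprime_self_add_left.mpr (Nat.coprime_one_left _) 
      rwa [Nat.sub_add_cancel hℓ] at this
    have : orderOf (f σ) ∣ 1 := by
      have := Nat.dvd_gcd h1 h2
      rwa [hcop] at this
    exact orderOf_eq_one_iff.1 (Nat.dvd_one.1 this)
  -- the image of inertia is cyclic, of order dividing `ℓ - 1`, and maps onto `(ℤ/ℓ)ˣ`
  obtain ⟨hcyc, -⟩ := absInertia_map_isCyclic_holds F (Equiv.Perm M × (ZMod ℓ)ˣ) f hwild
  set C : Subgroup (Equiv.Perm M × (ZMod ℓ)ˣ) := (absInertia F).map f.toMonoidHom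
  haveI : Finite C := inferInstance
  have hexp : Monoid.exponent C ∣ ℓ - 1 := by
    refine Monoid.exponent_dvd_of_forall_pow_eq_one fun c => ?_
    obtain ⟨σ, hσ, hσc⟩ := c.2
    apply Subtype.ext
    rw [SubmonoidClass.coe_pow, ← hσc]
    exact hpow σ hσ
  have hcardC : Nat.card C ∣ ℓ - 1 := by
    rw [← IsCyclic.exponent_eq_card]; exact hexp
  let π : C →* (ZMod ℓ)ˣ := (MonoidHom.snd _ _).comp C.subtype
  have hπsurj : Function.Surjective π := fun u => by
    obtain ⟨σ, hσ, hσu⟩ := hχI u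
    exact ⟨⟨f σ, Subgroup.mem_map_of_mem _ hσ⟩, hσu⟩
  have hπinj : Function.Injective π := by
    haveI : Fintype C := Fintype.ofFinite C
    have hcardle : Fintype.card (ZMod ℓ)ˣ ≤ Fintype.card C := Fintype.card_le_of_surjective π hπsurj
    have hcardeq : Fintype.card C = Fintype.card (ZMod ℓ)ˣ := by
      refine le_antisymm ?_ hcardle
      rw [ZMod.card_units, ← Nat.card_eq_fintype_card]
      exact Nat.le_of_dvd (Nat.sub_pos_of_lt (Fact.out : ℓ.Prime).one_lt) hcardC
    exact (Fintype.bijective_iff_surjective_and_card π).2 ⟨hπsurj, hcardeq⟩ |>.1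
  -- conclusion
  have hmem : (⟨f t, Subgroup.mem_map_of_mem _ ht⟩ : C) = 1 := by
    apply hπinj
    rw [map_one]
    change (f t).2 = 1
    rw [hf]; exact hχt
  have hft : A t = 1 := by
    have := congrArg (fun c : C => (c.1).1) hmem
    simpa [hf] using this
  have h0 := congrArg (fun σ : Equiv.Perm M => σ 0) hft
  rw [hA, Equiv.Perm.one_apply, map_zero, zero_add] at h0
  exact h0

omit [Finite M] [Fact ℓ.Prime] [NeZero (ℓ : F)] in
/-- A cocycle is additive on the inertia group of an unramified module. [folklore] -/
theorem cocycle_apply_mul_of_mem_absInertia (hI : ∀ t ∈ absInertia F, ∀ m : M, ρF t m = m)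
    (φ : contOneCocycles ρF.toTopRep) {t t' : absoluteGaloisGroup F} (ht : t ∈ absInertia F) :
    φ.1 (t * t') = φ.1 t + φ.1 t' := by
  rw [φ.2 t t']
  exact congrArg _ (hI t ht _)

omit [Finite M] [Fact ℓ.Prime] [NeZero (ℓ : F)] in
/-- `φ t⁻¹ = -φ t` on the inertia group of an unramified module. [folklore] -/
theorem cocycle_apply_inv_of_mem_absInertia (hI : ∀ t ∈ absInertia F, ∀ m : M, ρF t m = m)
    (φ : contOneCocycles ρF.toTopRep) {t : absoluteGaloisGroup F} (ht : t ∈ absInertia F) :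
    φ.1 t⁻¹ = -φ.1 t := by
  have h1 : φ.1 1 = 0 := by
    have h := φ.2 1 1
    rw [mul_one] at h
    have h2 : ρF.toTopRep.ρ 1 (φ.1 1) = φ.1 1 := by simp
    rw [h2] at h
    have h' : φ.1 1 + φ.1 1 = φ.1 1 + 0 := by rw [add_zero]; exact h.symm
    exact add_left_cancel h'
  have h := cocycle_apply_mul_of_mem_absInertia ρF hI φ (t' := t) ((absInertia F).inv_mem ht)
  rw [inv_mul_cancel, h1] at h
  exact (neg_eq_of_add_eq_zero_left h.symm).symm

omit [Finite M] [Fact ℓ.Prime] [NeZero (ℓ : F)] in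
/-- `Γ_F`-equivariance of a cocycle on the inertia group of an unramified module:
`φ (g t g⁻¹) = g · φ t`. [folklore] -/
theorem cocycle_apply_conj_of_mem_absInertia (hI : ∀ t ∈ absInertia F, ∀ m : M, ρF t m = m)
    (φ : contOneCocycles ρF.toTopRep) (g : absoluteGaloisGroup F) {t : absoluteGaloisGroup F}
    (ht : t ∈ absInertia F) : φ.1 (g * t * g⁻¹) = ρF g (φ.1 t) := by
  have hgg : φ.1 g + ρF g (φ.1 g⁻¹) = 0 := by
    have h := φ.2 g g⁻¹
    rw [mul_inv_cancel] at h
    have h1 : φ.1 1 = 0 := by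
      have h0 := cocycle_apply_mul_of_mem_absInertia ρF hI φ (t := 1) (t' := 1) (one_mem _)
      rw [mul_one] at h0
      have h' : φ.1 1 + φ.1 1 = φ.1 1 + 0 := by rw [add_zero]; exact h0.symm
      exact add_left_cancel h'
    rw [h1] at h
    exact h.symm
  have h := φ.2 (g * t) g⁻¹
  rw [φ.2 g t] at h
  -- `h : φ (g t g⁻¹) = φ g + ρ g (φ t) + ρ (g t) (φ g⁻¹)`
  change φ.1 (g * t * g⁻¹) = φ.1 g + ρF g (φ.1 t) + ρF (g * t) (φ.1 g⁻¹) at h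
  rw [h, map_mul ρF g t, Module.End.mul_apply, hI t ht]
  have : φ.1 g + ρF g (φ.1 t) + ρF g (φ.1 g⁻¹) = ρF g (φ.1 t) + (φ.1 g + ρF g (φ.1 g⁻¹)) := by abel
  rw [this, hgg, add_zero]

/-- **Step B of (UT): `H¹_ur ⊔ 𝒯 = ⊤`** — every class is an unramified class plus a
cyclotomic-transverse one (Rubin PCMI Prop. 1.9.5 (3), the half `H¹ = H¹_u + H¹_t`): the
restriction of a cocycle `φ` to `I_F` factors through `I_F/(I_F ∩ ker χ̄_ℓ) ≅ (ℤ/ℓ)ˣ` (Step A)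
with `Γ_F`-invariant values; transported along `χ̄_ℓ` it is a cocycle `φ₂` vanishing on `ker χ̄_ℓ`
(transverse) with `φ − φ₂` vanishing on `I_F` (unramified).
[cite: Rubin2011, Prop. 1.9.5 (3) (p. 16)] [cite: MazurRubin2004, Lemma 1.2.1] -/
theorem unramifiedSubgroup_sup_transverseSubgroup_cyclotomicField_eq_top
    (hchar : ringChar 𝓀[F] = ℓ)
    (hI : ∀ t ∈ absInertia F, ∀ m : M, ρF t m = m)
    (hM : ∀ m : M, (ℓ - 1) • m = 0)
    (hχI : ∀ u : (ZMod ℓ)ˣ, ∃ t ∈ absInertia F, modPCyclotomicCharacterZMod F ℓ t = u) :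
    DiscreteGaloisModule.unramifiedSubgroup ρF 1 ⊔
      DiscreteGaloisModule.transverseSubgroup ρF (CyclotomicField ℓ F) = ⊤ := by
  classical
  set χ := modPCyclotomicCharacterZMod F ℓ
  -- inertia lifts of the units
  choose s hsI hsχ using hχI
  -- Step A, in the form `χ t = χ t' ⟹ φ t = φ t'` on inertia
  have hA : ∀ (φ : contOneCocycles ρF.toTopRep) {t t' : absoluteGaloisGroup F},
      t ∈ absInertia F → t' ∈ absInertia F → χ t = χ t' → φ.1 t = φ.1 t' := by
    intro φ t t' ht ht' htt'
    have h0 := cocycle_apply_eq_zero_of_mem_absInertia_of_modPCyclotomicCharacterZMod_eq_one ρF ℓ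
      hchar hI hM (fun u => ⟨s u, hsI u, hsχ u⟩) φ ((absInertia F).mul_mem ht ((absInertia F).inv_mem ht'))
      (by rw [map_mul, map_inv, htt', mul_inv_cancel])
    rw [cocycle_apply_mul_of_mem_absInertia ρF hI φ ht, cocycle_apply_inv_of_mem_absInertia ρF hI φ ht',
      ← sub_eq_add_neg, sub_eq_zero] at h0
    exact h0
  -- fibres of `χ` are open
  have hχopen : ∀ u : (ZMod ℓ)ˣ, IsOpen {g : absoluteGaloisGroup F | χ g = u} := by
    intro u
    have hset : {g : absoluteGaloisGroup F | χ g = u} = (fun g => (s u)⁻¹ * g) ⁻¹' (χ.ker : Set _) := by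
      ext g
      simp only [Set.mem_setOf_eq, Set.mem_preimage, SetLike.mem_coe, MonoidHom.mem_ker, map_mul,
        map_inv, hsχ u]
      rw [inv_mul_eq_one, eq_comm]
    rw [hset]
    haveI : χ.ker.FiniteIndex := by
      haveI : Finite (absoluteGaloisGroup F ⧸ χ.ker) :=
        Finite.of_injective _ (QuotientGroup.kerLift_injective χ)
      exact Subgroup.finiteIndex_of_finite_quotient
    exact (Subgroup.isOpen_of_isClosed_of_finiteIndex χ.ker
      (isClosed_ker_modPCyclotomicCharacterZMod ℓ)).preimage (continuous_const.mul continuous_id)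
  refine eq_top_iff.2 fun c _ => ?_
  obtain ⟨φ, rfl⟩ := oneCocycleClass_surjective ρF.toTopRep c
  -- the transported cocycle `φ₂ g = φ (s (χ g))`
  have hinv : ∀ (g : absoluteGaloisGroup F) (u : (ZMod ℓ)ˣ), ρF g (φ.1 (s u)) = φ.1 (s u) := by
    intro g u
    rw [← cocycle_apply_conj_of_mem_absInertia ρF hI φ g (hsI u)]
    refine hA φ ?_ (hsI u) ?_
    · exact (inferInstance : (absInertia F).Normal).conj_mem _ (hsI u) g
    · rw [map_mul, map_mul, map_inv, hsχ, mul_inv_cancel_comm]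
  have hcont₂ : Continuous fun g : absoluteGaloisGroup F => φ.1 (s (χ g)) := by
    refine continuous_discrete_rng.2 fun m => ?_
    have hset : (fun g : absoluteGaloisGroup F => φ.1 (s (χ g))) ⁻¹' {m} =
        ⋃ u ∈ {u : (ZMod ℓ)ˣ | φ.1 (s u) = m}, {g | χ g = u} := by
      ext g
      simp only [Set.mem_preimage, Set.mem_singleton_iff, Set.mem_iUnion, Set.mem_setOf_eq,
        exists_prop, exists_eq_right']
    rw [hset]
    exact isOpen_biUnion fun u _ => hχopen u
  let φ₂ : contOneCocycles ρF.toTopRep :=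
    ⟨⟨fun g => φ.1 (s (χ g)), hcont₂⟩, fun g h => by
      change φ.1 (s (χ (g * h))) = φ.1 (s (χ g)) + ρF g (φ.1 (s (χ h)))
      rw [hinv, ← cocycle_apply_mul_of_mem_absInertia ρF hI φ (hsI _)]
      refine hA φ (hsI _) ((absInertia F).mul_mem (hsI _) (hsI _)) ?_
      rw [hsχ, map_mul, map_mul, hsχ, hsχ]⟩
  have hφ₂ : ∀ g, φ₂.1 g = φ.1 (s (χ g)) := fun _ => rfl
  -- `[φ₂]` is transverse
  have h2 : oneCocycleClass ρF.toTopRep φ₂ ∈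
      DiscreteGaloisModule.transverseSubgroup ρF (CyclotomicField ℓ F) := by
    rw [mem_transverseSubgroup_cyclotomicField_iff]
    refine ⟨0, fun g hg => ?_⟩
    rw [map_zero, sub_zero, hφ₂]
    change χ g = 1 at hg
    rw [hg]
    exact cocycle_apply_eq_zero_of_mem_absInertia_of_modPCyclotomicCharacterZMod_eq_one ρF ℓ hchar hI
      hM (fun u => ⟨s u, hsI u, hsχ u⟩) φ (hsI 1) (hsχ 1)
  -- `[φ - φ₂]` is unramified
  have h1 : oneCocycleClass ρF.toTopRep (φ - φ₂) ∈ DiscreteGaloisModule.unramifiedSubgroup ρF 1 := by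
    rw [X11b.LocBridge.mem_unramifiedSubgroup_one_iff_forall_eq_zero ρF hI]
    intro t ht
    change (φ.1 - φ₂.1) t = 0
    rw [ContinuousMap.sub_apply, sub_eq_zero, hφ₂]
    exact hA φ ht (hsI _) (hsχ _).symm
  rw [show oneCocycleClass ρF.toTopRep φ =
      oneCocycleClass ρF.toTopRep (φ - φ₂) + oneCocycleClass ρF.toTopRep φ₂ by
    rw [oneCocycleClass_sub, sub_add_cancel]]
  exact AddSubgroup.add_mem_sup h1 h2

end TransverseVanishing


end Summit.BirchSwinnertonDyer.Rank1Residual.GaloisImage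

end
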